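import Summits.QuantumFields.BalabanUV.Beta.SpineRecursiveWEndComb
import Summits.QuantumFields.BalabanUV.Beta.ReflectionLocusCombPure
import Summits.QuantumFields.BalabanUV.Beta.ReflectionLocusSymPure
import Summits.QuantumFields.BalabanUV.Beta.SpineRecursiveInductive

/-!
# `BalabanUV.Beta.SpineRecursiveWEndCombTables` — binder row D1, RULING R-D1-g35-1 (chart (III′)), brick P6-6: **THE (Wr-conj-c) LAW OF THE COMB LITERAL's W-TABLES
# OVER A TABLE RECORD `tabs : SymTables 3 Lc` AT an1's SHIFT `Dsh Lc` AND THE LITERAL's PINS `(cE, cVH) = (Lc⁴, −Lc⁸∕2)`, EVERY LEVEL, FROM THE TABLE LETTERS** —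
# the (III′) twin of `SpineRecursiveWEndSymTables` (gen 31, (N7d-ii)): `SpineRecursiveWEndComb.WrecOf_brefC_of_letters_comb` at `d = 3` with the pure tables'
# first-order law DISCHARGED from (V-r)(V-ff0)(H-r) (`ReflectionLocusCombPure.SpureCombOf_bref_all`) and the first units lock from the pin; `Gsym ↦ GcombSh`.
# Its conclusion is the hypothesis `hWrC` of ROOT F⁗ `CombChartJointEndTablesAn1` with `X₂ := diagK X2s`, `Rm := ½•conjV 𝕄 (diagK (X2sᵀ − X2s)) + ½•(Δ + Δᵀ)`.

HONEST FRAMING (cell charter, verbatim): «discharging BetaPertH makes Bałaban's UV stability UNCONDITIONAL — a real constructive-QFT result; it is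
NOT the continuum limit and NOT the Clay problem.»  HONEST DEPENDENCY: continuum YM on T⁴ ⇐ BetaPertH ∧ nine spine estimates (0/9 proved); BetaPertH
⇐ (D1) ∧ (D4) ∧ CAP+tail; G-an2-4 gates asym, D1 and NE2/3/4.  DERIVED cell leaf (wiring, [folklore]; β sub-cell, row-D1 OWNER `b2b-balaban-beta-an2` gen 36, programme
P6); no statement of Bałaban's papers, no `[cite:]`, no `def`, no `Prop` fact; EVERY second-order LETTER IS A HYPOTHESIS; instantiates no binder of the wall.  RECORD = ROOT M′
p303989 (chart (II)) unchanged.  NOT D1, NOT `BetaPertH`, NOT continuum, NOT Clay.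
(p-4) of REFEREE C-d1ref78-1 ∕ I-d1ref76-3 — WHICH chart-(II) PERMUTATION-SYMMETRY STEPS THIS DISCHARGE DOES NOT RE-USE: ALL OF THEM, i.e. it re-uses NONE.
The (Wr-conj-c) discharge below and the whole (III′) spine under it (P6-1 … P6-5, P6-0b) consume of the resolvent `G′ = GcombSh Lc` ONLY (DG′) `decays_GcombSh`,
(RG′) the REFLECTION rule `refK_coDressKAt_Gsym` (`Odd Lc`), (SG′)(TG′) and the P2 block facts of `CombChartResolventRules` ∕ `CombChartShiftNull`; no `S_d`
permutation ∕ axial-permutation ∕ swap rule of `Gsym` or `GcombSh` occurs anywhere in the chain (token census `perm` ∕ `axialPerm` ∕ `swap` = 0, an3 g86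
W-an3-g86-1 (c)); the W-remainder `Rm j α …` concluded here is cut PER REFLECTION AXIS `α` (HRM0-AN3 §3 (ρ3) honoured by construction).
Provenance: β sub-cell, unit beta-an2 gen 36, 2026-08-22 (v1; text of `SpineRecursiveWEndSymTables` transformed by name) ∕ gen 37 (v1.1: this (p-4) paragraph,
docstring only); no existing file touched.
-/

open Finset
open scoped BigOperators
open Literature.Probability.LatticeModels (Torus.proj)
open Literature.MathematicalPhysics.QuantumFieldTheory
open Literature.MathematicalPhysics.QuantumFieldTheory.Balaban1983to89
open Literature.MathematicalPhysics.QuantumFieldTheory.Balaban1983to89.Beta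
open ExpKernelCalculus (MKer Decays BiLoc comp VertexFamily)
open PolarizationSign (reflSign)
open KernelReflection (refK)
open ResolventReflection (bref Φ)
open AffineAveraging (unitVec)
open AveragingContours (blk)
open LatticeForm (quo)
open OneStepResolventKernel (Fib LocStencil)
open OneStepKernelFamily (KInvStep colH vertexOfK)
open BalabanStepJetsSucc (mmRead wE wVH)
open BalabanStepW2 (M2Of wV4 wB2)
open BalabanCompositeJets (LocStencil₂)
open SecondOrderResponse (dM W2OfK LocStencilFM)
open Summit.QuantumFields.BalabanUV.Beta.TameKernelCalculus
open Summit.QuantumFields.BalabanUV.Beta.ChartConjugation (conjV conjW)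
open Summit.QuantumFields.BalabanUV.Beta.AxialDressingRooted (one_le_of_neZero)
open Summit.QuantumFields.BalabanUV.Beta.BorderedHessian (bhK diagK stepScale stepScale_ne_zero)
open Summit.QuantumFields.BalabanUV.Beta.SymSliceProjectorKernel (symEc)
open Summit.QuantumFields.BalabanUV.Beta.WardLocusCubic (mmSym)
open Summit.QuantumFields.BalabanUV.Beta.WardLocusRecursive (SrecOf)
open Summit.QuantumFields.BalabanUV.Beta.ChartConjugationDefectEnd (sandwichDefect)
open Summit.QuantumFields.BalabanUV.Beta.SymmetrisedStepJets (SymTables)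
open Summit.QuantumFields.BalabanUV.Beta.CombChartStepJets (GcombSh SpureCombOf)
open Summit.QuantumFields.BalabanUV.Beta.DshAn1 (Dsh)
open Summit.QuantumFields.BalabanUV.Beta.SymShiftedSpread (bhKStepSh)
open Summit.QuantumFields.BalabanUV.Beta.E3ContactGenerator (ctGenM)
open Summit.QuantumFields.BalabanUV.Beta.VertexReflectionContact (smul_diagK)
open Summit.QuantumFields.BalabanUV.Beta.ReflectionLocusCombPure (SpureCombOf_bref_all)
open Summit.QuantumFields.BalabanUV.Beta.DshAn1 (Dsh lam04 Dsh_inl_inl Dsh_inr_inr Dsh_inr_inl_eq_neg Dsh_inl_inr_eq_sub lam04_eq_zero_of_ne_blk spr_Dsh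
  comp_comp_symEc_Dsh_symEc)

noncomputable section

namespace Summit.QuantumFields.BalabanUV.Beta.SpineRooted

section WEndCombTables

variable {Lc : ℕ} [NeZero Lc]

/-- [folklore] **THE (Wr-conj-c) LAW OF THE (0.4) LITERAL's W-TABLES OVER A TABLE RECORD AT an1's SHIFT AND THE LITERAL's PINS, EVERY LEVEL, FROM THE
TABLE LETTERS** (see the module docstring). -/
theorem WrecOf_brefC_of_tableLetters_comb (hLc : Odd Lc) (tabs : SymTables 3 Lc) (cΛ cE₂ cB : ℝ) (T : Fin 4 → Fin 4 → Fin 4 → Fin 4 → ℝ)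
    -- the first-order TABLE letters (V-r) (three border leg pairs, every axis), (V-ff0), (H-r)
    (hVfm : ∀ (α κ' : Fin 4) (u x z : Fin 4 → ℤ) (β μ : Fin 4), tabs.V κ' (bref α κ' u) x z (Sum.inl β) (Sum.inr μ) =
      (reflSign α κ' • refK (Φ (d := 3) Lc α) (tabs.V κ' u + conjV (bhK (d := 3) Lc + Dsh Lc)
        ((((Lc : ℝ) ^ 4)⁻¹) • diagK (ctGenM 3 (bhK Lc + Dsh Lc) α Lc κ' u)))) x z (Sum.inl β) (Sum.inr μ))
    (hVmf : ∀ (α κ' : Fin 4) (u x z : Fin 4 → ℤ) (μ β : Fin 4), tabs.V κ' (bref α κ' u) x z (Sum.inr μ) (Sum.inl β) =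
      (reflSign α κ' • refK (Φ (d := 3) Lc α) (tabs.V κ' u + conjV (bhK (d := 3) Lc + Dsh Lc)
        ((((Lc : ℝ) ^ 4)⁻¹) • diagK (ctGenM 3 (bhK Lc + Dsh Lc) α Lc κ' u)))) x z (Sum.inr μ) (Sum.inl β))
    (hVmm : ∀ (α κ' : Fin 4) (u x z : Fin 4 → ℤ) (μ μ' : Fin 4), tabs.V κ' (bref α κ' u) x z (Sum.inr μ) (Sum.inr μ') =
      (reflSign α κ' • refK (Φ (d := 3) Lc α) (tabs.V κ' u + conjV (bhK (d := 3) Lc + Dsh Lc)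
        ((((Lc : ℝ) ^ 4)⁻¹) • diagK (ctGenM 3 (bhK Lc + Dsh Lc) α Lc κ' u)))) x z (Sum.inr μ) (Sum.inr μ'))
    (hV0 : ∀ (κ : Fin 4) (w x z : Fin 4 → ℤ) (β β' : Fin 4), tabs.V κ w x z (Sum.inl β) (Sum.inl β') = 0)
    (hHr : ∀ (α μ : Fin 4) (y : Fin 4 → ℤ), tabs.H μ (bref α μ y) = reflSign α μ • refK (Φ (d := 3) Lc α) (tabs.H μ y))
    (hB0 : ∀ κ u κ' u' (x z : Fin 4 → ℤ) (β β' : Fin 4), tabs.vh₂S κ u κ' u' x z (Sum.inl β) (Sum.inl β') = 0)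
    -- the first-order contact coefficients (the root's `hγ`, verbatim) and the second units lock
    (γ : ℕ → ℝ) (hγ : ∀ j, γ j = -((Lc : ℝ) ^ 8 / 2) * wVH 3 Lc j / (stepScale 3 Lc j * (Lc : ℝ) ^ 4))
    (hlock2 : ∀ j, cE₂ * wV4 3 Lc (j + 1) * wVH 3 Lc (j + 1) = ((Lc : ℝ) ^ 4 * wE 3 Lc (j + 1)) ^ 2)
    (h : ℕ → Fin 4 → Fin 4 → (Fin 4 → ℤ) → Fin 4 → (Fin 4 → ℤ) → (Fin 4 → ℤ) → Fib 3 → ℝ)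
    (R2 : ℕ → Fin 4 → Fin 4 → (Fin 4 → ℤ) → Fin 4 → (Fin 4 → ℤ) → MKer 4 (Fib 3))
    (RM : ℕ → Fin 4 → Fin 4 → (Fin 4 → ℤ) → Fin 4 → (Fin 4 → ℤ) → MKer 4 (Fib 3))
    (h0 : ∀ (α κ : Fin 4) (u : Fin 4 → ℤ) (κ' : Fin 4) (u' : Fin 4 → ℤ),
      T2RecOf 3 Lc (GcombSh Lc) (SpureRecOf 3 Lc tabs.V tabs.H (GcombSh Lc) ((Lc : ℝ) ^ 4) (-((Lc : ℝ) ^ 8 / 2)) cΛ) (M1Of 3 Lc tabs.H cΛ) cE₂ cB T tabs.vh₂S tabs.mixFF 0 κ (bref α κ u) κ' (bref α κ' u') =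
        (reflSign α κ * reflSign α κ') • refK (Φ Lc α)
          (T2RecOf 3 Lc (GcombSh Lc) (SpureRecOf 3 Lc tabs.V tabs.H (GcombSh Lc) ((Lc : ℝ) ^ 4) (-((Lc : ℝ) ^ 8 / 2)) cΛ) (M1Of 3 Lc tabs.H cΛ) cE₂ cB T tabs.vh₂S tabs.mixFF 0 κ u κ' u' +
            conjW (bhKStepSh 3 Lc (Dsh Lc) 0) (SpureRecOf 3 Lc tabs.V tabs.H (GcombSh Lc) ((Lc : ℝ) ^ 4) (-((Lc : ℝ) ^ 8 / 2)) cΛ 0 κ u) (SpureRecOf 3 Lc tabs.V tabs.H (GcombSh Lc) ((Lc : ℝ) ^ 4) (-((Lc : ℝ) ^ 8 / 2)) cΛ 0 κ' u')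
              (diagK fun p c => γ 0 * ctGenM 3 (bhK Lc + Dsh Lc) α Lc κ u p c) (diagK fun p c => γ 0 * ctGenM 3 (bhK Lc + Dsh Lc) α Lc κ' u' p c) (diagK (h 0 α κ u κ' u')) +
            R2 0 α κ u κ' u'))
    (hM2 : ∀ (j : ℕ) (α κ : Fin 4) (u : Fin 4 → ℤ) (ρ : Fin 4) (w : Fin 4 → ℤ),
      M2Of 3 Lc tabs.mixFF j κ (bref α κ u) ρ (bref α ρ w) =
        (reflSign α κ * reflSign α ρ) • refK (Φ Lc α)
          (M2Of 3 Lc tabs.mixFF j κ u ρ w + conjV (M1Of 3 Lc tabs.H cΛ j ρ w) (diagK fun p c => γ j * ctGenM 3 (bhK Lc + Dsh Lc) α Lc κ u p c) + RM j α κ u ρ w))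
    (X2s : ℕ → Fin 4 → Fin 4 → (Fin 4 → ℤ) → Fin 4 → (Fin 4 → ℤ) → (Fin 4 → ℤ) → Fib 3 → ℝ)
    (Δ : ℕ → Fin 4 → Fin 4 → (Fin 4 → ℤ) → Fin 4 → (Fin 4 → ℤ) → MKer 4 (Fib 3))
    (hsplit : ∀ (j : ℕ) (α μ : Fin 4) (y : Fin 4 → ℤ) (ν : Fin 4) (y' : Fin 4 → ℤ),
      W2OfK (GcombSh (d := 3) Lc j) Lc
          (fun κ u => SpureRecOf 3 Lc tabs.V tabs.H (GcombSh Lc) ((Lc : ℝ) ^ 4) (-((Lc : ℝ) ^ 8 / 2)) cΛ j κ u + conjV (bhKStepSh 3 Lc (Dsh Lc) j) (diagK fun p c => γ j * ctGenM 3 (bhK Lc + Dsh Lc) α Lc κ u p c))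
          (M1Of 3 Lc tabs.H cΛ j)
          (fun κ u κ' u' => T2RecOf 3 Lc (GcombSh Lc) (SpureRecOf 3 Lc tabs.V tabs.H (GcombSh Lc) ((Lc : ℝ) ^ 4) (-((Lc : ℝ) ^ 8 / 2)) cΛ) (M1Of 3 Lc tabs.H cΛ) cE₂ cB T tabs.vh₂S tabs.mixFF j κ u κ' u' +
            conjW (bhKStepSh 3 Lc (Dsh Lc) j) (SpureRecOf 3 Lc tabs.V tabs.H (GcombSh Lc) ((Lc : ℝ) ^ 4) (-((Lc : ℝ) ^ 8 / 2)) cΛ j κ u) (SpureRecOf 3 Lc tabs.V tabs.H (GcombSh Lc) ((Lc : ℝ) ^ 4) (-((Lc : ℝ) ^ 8 / 2)) cΛ j κ' u')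
              (diagK fun p c => γ j * ctGenM 3 (bhK Lc + Dsh Lc) α Lc κ u p c) (diagK fun p c => γ j * ctGenM 3 (bhK Lc + Dsh Lc) α Lc κ' u' p c) (diagK (h j α κ u κ' u')) +
            R2 j α κ u κ' u')
          (fun κ u ρ w => M2Of 3 Lc tabs.mixFF j κ u ρ w + conjV (M1Of 3 Lc tabs.H cΛ j ρ w) (diagK fun p c => γ j * ctGenM 3 (bhK Lc + Dsh Lc) α Lc κ u p c) + RM j α κ u ρ w)
          μ y ν y' =
        W2OfK (GcombSh (d := 3) Lc j) Lc (SpureRecOf 3 Lc tabs.V tabs.H (GcombSh Lc) ((Lc : ℝ) ^ 4) (-((Lc : ℝ) ^ 8 / 2)) cΛ j) (M1Of 3 Lc tabs.H cΛ j)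
            (T2RecOf 3 Lc (GcombSh Lc) (SpureRecOf 3 Lc tabs.V tabs.H (GcombSh Lc) ((Lc : ℝ) ^ 4) (-((Lc : ℝ) ^ 8 / 2)) cΛ) (M1Of 3 Lc tabs.H cΛ) cE₂ cB T tabs.vh₂S tabs.mixFF j)
            (M2Of 3 Lc tabs.mixFF j) μ y ν y' +
          conjW (bhKStepSh 3 Lc (Dsh Lc) j)
            (dM (GcombSh Lc j) Lc (SpureRecOf 3 Lc tabs.V tabs.H (GcombSh Lc) ((Lc : ℝ) ^ 4) (-((Lc : ℝ) ^ 8 / 2)) cΛ j) (M1Of 3 Lc tabs.H cΛ j) μ y)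
            (dM (GcombSh Lc j) Lc (SpureRecOf 3 Lc tabs.V tabs.H (GcombSh Lc) ((Lc : ℝ) ^ 4) (-((Lc : ℝ) ^ 8 / 2)) cΛ j) (M1Of 3 Lc tabs.H cΛ j) ν y')
            (diagK fun p c => ∑ κ, ∑' u, colH (GcombSh Lc j) Lc μ y κ u * (γ j * ctGenM 3 (bhK Lc + Dsh Lc) α Lc κ u p c))
            (diagK fun p c => ∑ κ, ∑' u, colH (GcombSh Lc j) Lc ν y' κ u * (γ j * ctGenM 3 (bhK Lc + Dsh Lc) α Lc κ u p c))
            (diagK (X2s j α μ y ν y')) +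
          Δ j α μ y ν y')
    (hDg : ∀ (j : ℕ) (α ν : Fin 4) (y' : Fin 4 → ℤ),
      Loc (dM (GcombSh (d := 3) Lc j) Lc (fun κ u => SpureRecOf 3 Lc tabs.V tabs.H (GcombSh Lc) ((Lc : ℝ) ^ 4) (-((Lc : ℝ) ^ 8 / 2)) cΛ j κ u + conjV (bhKStepSh 3 Lc (Dsh Lc) j) (diagK fun p c => γ j * ctGenM 3 (bhK Lc + Dsh Lc) α Lc κ u p c)) (M1Of 3 Lc tabs.H cΛ j) ν y'))
    (hX2L : ∀ j α μ y ν y', Loc (diagK (X2s j α μ y ν y'))) (hΔL : ∀ j α μ y ν y', Loc (Δ j α μ y ν y'))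
    (RB : ℕ → Fin 4 → Fin 4 → (Fin 4 → ℤ) → Fin 4 → (Fin 4 → ℤ) → MKer 4 (Fib 3))
    (hRBff : ∀ j α κ u κ' u' (x z : Fin 4 → ℤ) (β β' : Fin 4), RB j α κ u κ' u' x z (Sum.inl β) (Sum.inl β') = 0)
    (hBfm : ∀ (j : ℕ) (α : Fin 4) κ u κ' u' (x z : Fin 4 → ℤ) (β m : Fin 4),
      ((cB * wB2 3 Lc (j + 1)) • tabs.vh₂S κ (bref α κ u) κ' (bref α κ' u')) x z (Sum.inl β) (Sum.inr m) =
        ((reflSign α κ * reflSign α κ') • refK (Φ Lc α) ((cB * wB2 3 Lc (j + 1)) • tabs.vh₂S κ u κ' u' +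
          conjW (bhKStepSh 3 Lc (Dsh Lc) (j + 1)) (SpureRecOf 3 Lc tabs.V tabs.H (GcombSh Lc) ((Lc : ℝ) ^ 4) (-((Lc : ℝ) ^ 8 / 2)) cΛ (j + 1) κ u) (SpureRecOf 3 Lc tabs.V tabs.H (GcombSh Lc) ((Lc : ℝ) ^ 4) (-((Lc : ℝ) ^ 8 / 2)) cΛ (j + 1) κ' u')
            (diagK fun p c => γ (j + 1) * ctGenM 3 (bhK Lc + Dsh Lc) α Lc κ u p c) (diagK fun p c => γ (j + 1) * ctGenM 3 (bhK Lc + Dsh Lc) α Lc κ' u' p c)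
            (diagK (h (j + 1) α κ u κ' u')) + RB (j + 1) α κ u κ' u')) x z (Sum.inl β) (Sum.inr m))
    (hBmf : ∀ (j : ℕ) (α : Fin 4) κ u κ' u' (x z : Fin 4 → ℤ) (m β : Fin 4),
      ((cB * wB2 3 Lc (j + 1)) • tabs.vh₂S κ (bref α κ u) κ' (bref α κ' u')) x z (Sum.inr m) (Sum.inl β) =
        ((reflSign α κ * reflSign α κ') • refK (Φ Lc α) ((cB * wB2 3 Lc (j + 1)) • tabs.vh₂S κ u κ' u' +
          conjW (bhKStepSh 3 Lc (Dsh Lc) (j + 1)) (SpureRecOf 3 Lc tabs.V tabs.H (GcombSh Lc) ((Lc : ℝ) ^ 4) (-((Lc : ℝ) ^ 8 / 2)) cΛ (j + 1) κ u) (SpureRecOf 3 Lc tabs.V tabs.H (GcombSh Lc) ((Lc : ℝ) ^ 4) (-((Lc : ℝ) ^ 8 / 2)) cΛ (j + 1) κ' u')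
            (diagK fun p c => γ (j + 1) * ctGenM 3 (bhK Lc + Dsh Lc) α Lc κ u p c) (diagK fun p c => γ (j + 1) * ctGenM 3 (bhK Lc + Dsh Lc) α Lc κ' u' p c)
            (diagK (h (j + 1) α κ u κ' u')) + RB (j + 1) α κ u κ' u')) x z (Sum.inr m) (Sum.inl β))
    (hBmm : ∀ (j : ℕ) (α : Fin 4) κ u κ' u' (x z : Fin 4 → ℤ) (m m' : Fin 4),
      ((cB * wB2 3 Lc (j + 1)) • tabs.vh₂S κ (bref α κ u) κ' (bref α κ' u')) x z (Sum.inr m) (Sum.inr m') =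
        ((reflSign α κ * reflSign α κ') • refK (Φ Lc α) ((cB * wB2 3 Lc (j + 1)) • tabs.vh₂S κ u κ' u' +
          conjW (bhKStepSh 3 Lc (Dsh Lc) (j + 1)) (SpureRecOf 3 Lc tabs.V tabs.H (GcombSh Lc) ((Lc : ℝ) ^ 4) (-((Lc : ℝ) ^ 8 / 2)) cΛ (j + 1) κ u) (SpureRecOf 3 Lc tabs.V tabs.H (GcombSh Lc) ((Lc : ℝ) ^ 4) (-((Lc : ℝ) ^ 8 / 2)) cΛ (j + 1) κ' u')
            (diagK fun p c => γ (j + 1) * ctGenM 3 (bhK Lc + Dsh Lc) α Lc κ u p c) (diagK fun p c => γ (j + 1) * ctGenM 3 (bhK Lc + Dsh Lc) α Lc κ' u' p c)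
            (diagK (h (j + 1) α κ u κ' u')) + RB (j + 1) α κ u κ' u')) x z (Sum.inr m) (Sum.inr m'))
    (hR2succ : ∀ (j : ℕ) (α κ : Fin 4) (u : Fin 4 → ℤ) (κ' : Fin 4) (u' : Fin 4 → ℤ),
      R2 (j + 1) α κ u κ' u' =
          (-((cE₂ * wV4 3 Lc (j + 1)) • mmRead Lc
              (comp (comp (GcombSh Lc j) (((1 / 2 : ℝ) • conjV (bhKStepSh 3 Lc (Dsh Lc) j) (diagK fun p a => X2s j α κ' u' κ u p a - X2s j α κ u κ' u' p a) +
                (1 / 2 : ℝ) • (Δ j α κ u κ' u' + Δ j α κ' u' κ u)))) (GcombSh Lc j) -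
                (comp (sandwichDefect (GcombSh Lc j) (bhKStepSh 3 Lc (Dsh Lc) j)
                      (diagK fun p c => ∑ ι, ∑' v, colH (GcombSh Lc j) Lc κ u ι v * (γ j * ctGenM 3 (bhK Lc + Dsh Lc) α Lc ι v p c)))
                    (comp (dM (GcombSh Lc j) Lc (SpureRecOf 3 Lc tabs.V tabs.H (GcombSh Lc) ((Lc : ℝ) ^ 4) (-((Lc : ℝ) ^ 8 / 2)) cΛ j) (M1Of 3 Lc tabs.H cΛ j) κ' u') (GcombSh Lc j) -
                      diagK fun p c => ∑ ι, ∑' v, colH (GcombSh Lc j) Lc κ' u' ι v * (γ j * ctGenM 3 (bhK Lc + Dsh Lc) α Lc ι v p c))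
                  + comp (comp (GcombSh Lc j) (dM (GcombSh Lc j) Lc (SpureRecOf 3 Lc tabs.V tabs.H (GcombSh Lc) ((Lc : ℝ) ^ 4) (-((Lc : ℝ) ^ 8 / 2)) cΛ j) (M1Of 3 Lc tabs.H cΛ j) κ u +
                      conjV (bhKStepSh 3 Lc (Dsh Lc) j) (diagK fun p c => ∑ ι, ∑' v, colH (GcombSh Lc j) Lc κ u ι v * (γ j * ctGenM 3 (bhK Lc + Dsh Lc) α Lc ι v p c))))
                    (sandwichDefect (GcombSh Lc j) (bhKStepSh 3 Lc (Dsh Lc) j)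
                      (diagK fun p c => ∑ ι, ∑' v, colH (GcombSh Lc j) Lc κ' u' ι v * (γ j * ctGenM 3 (bhK Lc + Dsh Lc) α Lc ι v p c)))
                  + comp (sandwichDefect (GcombSh Lc j) (bhKStepSh 3 Lc (Dsh Lc) j)
                      (diagK fun p c => ∑ ι, ∑' v, colH (GcombSh Lc j) Lc κ' u' ι v * (γ j * ctGenM 3 (bhK Lc + Dsh Lc) α Lc ι v p c)))
                    (comp (dM (GcombSh Lc j) Lc (SpureRecOf 3 Lc tabs.V tabs.H (GcombSh Lc) ((Lc : ℝ) ^ 4) (-((Lc : ℝ) ^ 8 / 2)) cΛ j) (M1Of 3 Lc tabs.H cΛ j) κ u) (GcombSh Lc j) -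
                      diagK fun p c => ∑ ι, ∑' v, colH (GcombSh Lc j) Lc κ u ι v * (γ j * ctGenM 3 (bhK Lc + Dsh Lc) α Lc ι v p c))
                  + comp (comp (GcombSh Lc j) (dM (GcombSh Lc j) Lc (SpureRecOf 3 Lc tabs.V tabs.H (GcombSh Lc) ((Lc : ℝ) ^ 4) (-((Lc : ℝ) ^ 8 / 2)) cΛ j) (M1Of 3 Lc tabs.H cΛ j) κ' u' +
                      conjV (bhKStepSh 3 Lc (Dsh Lc) j) (diagK fun p c => ∑ ι, ∑' v, colH (GcombSh Lc j) Lc κ' u' ι v * (γ j * ctGenM 3 (bhK Lc + Dsh Lc) α Lc ι v p c))))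
                    (sandwichDefect (GcombSh Lc j) (bhKStepSh 3 Lc (Dsh Lc) j)
                      (diagK fun p c => ∑ ι, ∑' v, colH (GcombSh Lc j) Lc κ u ι v * (γ j * ctGenM 3 (bhK Lc + Dsh Lc) α Lc ι v p c)))))) +
            RB (j + 1) α κ u κ' u' +
            conjV (mmRead Lc (GcombSh (d := 3) Lc j))
              (diagK fun p c => cE₂ * wV4 3 Lc (j + 1) * mmSym Lc (X2s j α κ u κ' u') p c - wVH 3 Lc (j + 1) * h (j + 1) α κ u κ' u' p c))) :
    ∀ (j : ℕ) (α μ : Fin 4) (y : Fin 4 → ℤ) (ν : Fin 4) (y' : Fin 4 → ℤ),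
      WrecOf 3 Lc (GcombSh Lc) (SpureRecOf 3 Lc tabs.V tabs.H (GcombSh Lc) ((Lc : ℝ) ^ 4) (-((Lc : ℝ) ^ 8 / 2)) cΛ) (M1Of 3 Lc tabs.H cΛ) cE₂ cB T tabs.vh₂S tabs.mixFF j μ (bref α μ y) ν (bref α ν y') =
        (reflSign α μ * reflSign α ν) • refK (Φ Lc α)
          (WrecOf 3 Lc (GcombSh Lc) (SpureRecOf 3 Lc tabs.V tabs.H (GcombSh Lc) ((Lc : ℝ) ^ 4) (-((Lc : ℝ) ^ 8 / 2)) cΛ) (M1Of 3 Lc tabs.H cΛ) cE₂ cB T tabs.vh₂S tabs.mixFF j μ y ν y' +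
            conjW (bhKStepSh 3 Lc (Dsh Lc) j)
              (vertexOfK (GcombSh (d := 3) Lc j) Lc (SrecOf 3 Lc tabs.V tabs.H (GcombSh Lc) ((Lc : ℝ) ^ 4) (-((Lc : ℝ) ^ 8 / 2)) cΛ j) μ y)
              (vertexOfK (GcombSh (d := 3) Lc j) Lc (SrecOf 3 Lc tabs.V tabs.H (GcombSh Lc) ((Lc : ℝ) ^ 4) (-((Lc : ℝ) ^ 8 / 2)) cΛ j) ν y')
              (vertexOfK (GcombSh (d := 3) Lc j) Lc (fun κ u => γ j • diagK (ctGenM 3 (bhK Lc + Dsh Lc) α Lc κ u)) μ y)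
              (vertexOfK (GcombSh (d := 3) Lc j) Lc (fun κ u => γ j • diagK (ctGenM 3 (bhK Lc + Dsh Lc) α Lc κ u)) ν y')
              (diagK (X2s j α μ y ν y')) +
            ((1 / 2 : ℝ) • conjV (bhKStepSh 3 Lc (Dsh Lc) j) (diagK fun p a => X2s j α ν y' μ y p a - X2s j α μ y ν y' p a) +
              (1 / 2 : ℝ) • (Δ j α μ y ν y' + Δ j α ν y' μ y))) := by
  have hLc1 : 1 ≤ Lc := one_le_of_neZero Lc
  have e4 : ((Lc : ℝ) ^ (3 + 1)) = (Lc : ℝ) ^ 4 := by norm_num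
  have e8 : -((Lc : ℝ) ^ 4 * (1 / 2) * (Lc : ℝ) ^ 4) = -((Lc : ℝ) ^ 8 / 2) := by ring
  -- the first units lock from the pin
  have hlock : ∀ j, (Lc : ℝ) ^ 4 * wE 3 Lc (j + 1) * (γ j / (stepScale 3 Lc j * (Lc : ℝ) ^ (3 + 1))) / wVH 3 Lc (j + 1) = γ (j + 1) := by
    intro j
    have h1 := locks_of_pin (Lc := Lc) ((Lc : ℝ) ^ 4) (-((Lc : ℝ) ^ 8 / 2)) (pin_of_bcj (Lc := Lc) _ rfl) j
    rw [hγ, hγ, e4, ← h1]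
    ring
  -- the pure tables' first-order law from the table letters, at the literal's pins
  have hSp : ∀ (j : ℕ) (α κ : Fin 4) (u : Fin 4 → ℤ),
      SpureRecOf 3 Lc tabs.V tabs.H (GcombSh Lc) ((Lc : ℝ) ^ 4) (-((Lc : ℝ) ^ 8 / 2)) cΛ j κ (bref α κ u) =
        reflSign α κ • refK (Φ Lc α) (SpureRecOf 3 Lc tabs.V tabs.H (GcombSh Lc) ((Lc : ℝ) ^ 4) (-((Lc : ℝ) ^ 8 / 2)) cΛ j κ u +
          conjV (bhKStepSh 3 Lc (Dsh Lc) j) (diagK fun p c => γ j * ctGenM 3 (bhK Lc + Dsh Lc) α Lc κ u p c)) := by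
    intro j α κ u
    have h := SpureCombOf_bref_all hLc tabs cΛ (hVfm α) (hVmf α) (hVmm α) hV0 hHr j κ u
    rw [e8, smul_diagK, ← hγ j] at h
    exact h
  exact WrecOf_brefC_of_letters_comb (d := 3) hLc tabs.hV tabs.hH hV0 hHr
    ((Lc : ℝ) ^ 4) (-((Lc : ℝ) ^ 8 / 2)) cΛ cE₂ cB T tabs.hB hB0 tabs.hmix γ hlock hlock2 hSp h R2 RM h0 hM2 X2s Δ hsplit hDg hX2L hΔL RB hRBff hBfm
    hBmf hBmm hR2succ

end WEndCombTables

end Summit.QuantumFields.BalabanUV.Beta.SpineRooted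

end
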